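import Literature.MathematicalPhysics.QuantumFieldTheory.Balaban1983to89.B7TransferLog
import Literature.MathematicalPhysics.QuantumFieldTheory.TiltedExponentMorseBounds

/-!
# `Balaban1983to89.B7BlockAvgLog` — the block average `\overline{W}` of group-valued site variables of B7
# ((42) p. 23, (78)/(82) p. 30) and the FIRST EQUALITY of (162) p. 42: `log ∘ exp = id` on small elements

CITATION HEADER (lean-in-tree rule 2026-08-18).  Kernel analysis and definitional unfoldings for one displayed
step of T. Bałaban, *Averaging operations for lattice gauge theories*, Comm. Math. Phys. **98**, 17–51 (1985)
[Balaban1985Averaging] (cell paper B7 of the audit cell `pub-balaban`; `paper:balaban1985-cmp98-averaging`,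
journal page = PDF page + 16), read from the page renders `…1985-cmp98-averaging-pNNN-x2.png`, re-read as images
by the filing unit on 2026-08-18: p005 (p. 21), p006 (p. 22), p007 (p. 23), p008 (p. 24), p012 (p. 28), p014
(p. 30), p026 (p. 42).
PRINTED (p. 21): "The first is a logarithmic function. It is an inverse to the exponential function and for
matrices `X` satisfying `|X − 1| < 1` it is given by `log X = Σ_{n=1}^∞ ((−1)^{n+1}/n)(X − 1)^n`. (21)".
PRINTED (p. 22): "`|X − 1| = |e^{log X} − 1| ≤ e^{|log X|} − 1 ≤ e^{|log X|}|log X| ≤ 2|log X|`. (27)" and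
"`Z(u, v) = log e^{uX}e^{vY}`. (28)  It is a well-defined and analytic function of `uX`, `vY`, for example, in the
domain `|uX| < 1/8`, `|vY| < 1/8`."
PRINTED (p. 23): "The one-step averaging operation is defined by
`Ū_c = exp[i Σ_{x∈B(c₋)} L^{-d} (1/i) log U(Γ_{c,x})U(c)^{-1}] U(c)`, `c ⊂ Ω^{(1)}`, (42)".
PRINTED (p. 30): "`(R̄₀v)(y) = (\overline{R(V₀)v})(y) = \overline{{(R(V₀)v)(x)}_{x∈B(y)}}
= v(y) exp[i Σ_{x∈B(y)} L^{-d} (1/i) log v^{-1}(y)R(V₀(Γ_{y,x}))v(x)]`, (78)" and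
"`(R̄₀u)(x₁) = u(x₁)(\overline{R_{0,x₁}U₁})(Γ_{x₁,·}) = u(x₁)\overline{R_{0,x₁}U₁}` (82) for `x₁ ∈ Ω^{(1)}`, where the
expression `\overline{R_{0,x₁}U₁}` is defined by the last equation."
PRINTED (p. 42): "`v_k(x) = (\overline{R̄_{0,x}Ū′})(\overline{R̄_{0,x}U̿′})·…·(\overline{R̄^{k−1}_{0,x}Ū′^{k−1}})`,
`x ∈ Ω^{(k)}`. (160)  From Proposition 4, and especially from (131), we get
`|(1/i) log Ū′^j| = |Q_j(U₀, ηA′)| < 2α₁L^jη`, (161)  hence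
`|(1/i) log(\overline{R̄^j_{0,x}U̿′^j})| = |Σ_{x_j∈B(x)} L^{-d} (1/i) log(R̄^j_{0,x}U̿′^j)(Γ_{x,x_j})|
< 8α₁dL^{j+1}η e^{2α₁dL^{j+1}η} < O(1)α₁L^{j+1}η`, `j = 0, 1, …, k−1` (162)  and
`|v_k(x) − 1| < O(1)α₁ Σ_{j=0}^{k−1} L^{j+1}η ≦ O(1)α₁` (163)  for `α₁` sufficiently small."
PRINTED (p. 34): "`\overline{R_{0,y}V₁} = exp[i Σ_{x∈B(y)} L^{-d} (1/i) log(R_{0,y}V₁)(Γ_{y,x})]` … (110)".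
The paper is a manuscript UNDER ADJUDICATION by the cell; nothing of it is asserted here.  No hypothesis of this
file is a statement of the paper: §1 is [folklore] Banach-algebra analysis, §2 is a definition, §§3–4 are
implications whose every printed input is an explicit binder.

v1.1 (unit b2b-balaban-b07 gen 5, DOCSTRING-ONLY): the `barAvg` docstring now cites the (110) p. 34
instance of the shape and records the two base-point conventions of the printed bars (cell census G-adv4-8 (i));
no declaration is touched.

WHAT THE TREE ALREADY HAS.  `MatrixLog` (unit f1-g4): the series (21) `mlog`, `exp_mlog` (`e^{log X} = X` for
`|X − 1| < 1`), `analyticAt_mlog`, (26) `norm_mlog_le_two_mul`, the (27)-members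
`norm_sub_one_le_exp_norm_mlog_sub_one` / `norm_sub_one_le_two_mul_norm_mlog`.  `B7Transfer` (unit b07-g2):
`ineq162_of_161` (the chain behind (162) for one path product), `convex_comb_norm_le`, `norm_exp_sub_one_le_of_le`.
`B7TransferLog` (unit pv14): `ineq162_log_of_161` (ONE summand of the middle member of (162):
`‖(1/i) log ∏‖ ≤ 8α₁d(Lℓ)e^{2α₁d(Lℓ)}`) and `ineq162_blockAvg_of_161` (the MIDDLE member of (162) typed as a convex
combination); its header records "NOT typed here: the first equality of (162) … which is the definition (78)/(85)
of the block average of site variables (an `exp` of `i`× that average) followed by `log ∘ exp = id` on small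
elements; it needs the carrier of (78), which the tree does not have".  `B7Prop6Bound` (unit adv1):
`ineq163_explicit` ((162)-shaped factor bounds ⇒ (163) with an explicit constant); its header records "NOT
certified here (printed inputs): (161) (Prop. 4, (131)) and the group-theoretic step (161) ⇒ (162)".

WHAT THIS FILE ADDS (kernel-checked; new sibling module, nothing above is edited).
§1 `log ∘ exp = id` on small elements of a complete normed `ℂ`-algebra [folklore]: `commute_logOnePlus_right` /
`commute_mlog_right`; `eq_zero_of_exp_eq_one` (`‖D‖ < 1 ∧ e^D = 1 ⇒ D = 0`, from the tree's
`OneLinkLaplace.norm_exp_sub_one_sub_le_sq`, module `TiltedExponentMorseBounds`); `mlog_exp` (`‖C‖ < ln 2 ⇒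
log e^C = C`, by continuity induction on `s ↦ log e^{sC} − sC` over `[0,1]`, all of whose values `D` satisfy
`e^D = 1`) — the sentence "It is an inverse to the exponential function" (p. 21) in the direction `MatrixLog` did
not type.  The radius `ln 2` is where
`‖e^C − 1‖ ≤ e^{‖C‖} − 1 < 1` holds; it is sharp for the SERIES (21) (`𝔸 = ℂ`, `C = ln 2`: `e^C − 1 = 1` lies on the
boundary of the disc of convergence, where the non-summable alternating series has `tsum`-value `0 ≠ ln 2`).
§2 the carrier `barAvg t wt W = exp(i Σ_{x∈t} wt_x (1/i) log W_x)` — the printed shape of (42)/(43), (78) and of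
the symbol `\overline{R_{0,x₁}U₁}` of (82), i.e. the object under the bar in (160)–(162): index set `t` (the sites
`x ∈ B(y)`), real weights `wt` (`L^{-d}`), site variables `W_x`, `log` = (21) `MatrixLog.mlog`; `barAvg_eq_exp_sum`.
§3 the FIRST EQUALITY of (162): `ineq162_firstEq` (`(1/i) log \overline{W} = Σ_x wt_x (1/i) log W_x` whenever the
right side has norm `< ln 2`), `ineq162_first_of_bound` (convex weights and a uniform per-site bound `K < ln 2`
give the equality and the LEFT member bound `≤ K`), `rad162_of_small` (`2dα₁(Lℓ) ≤ 1/8 ⇒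
8α₁d(Lℓ)e^{2α₁d(Lℓ)} < ln 2`; numerics `Real.exp_bound_div_one_sub_of_interval'`, `Real.log_two_gt_d9`), and
`ineq162_barAvg_of_161`: the whole printed chain (162) — LEFT member `=` MIDDLE member `≤ 8α₁d(Lℓ)e^{2α₁d(Lℓ)}` —
for B7's own average of the path products of `B7TransferLog.ineq162_blockAvg_of_161`, under that theorem's
hypotheses with the smallness sharpened from `2dα₁(Lℓ) ≤ 1/3` to `2dα₁(Lℓ) ≤ 1/8`.
§4 the seam (162) ⇒ (163): `norm_barAvg_sub_one_le` (`‖\overline{W} − 1‖ ≤ Ke^K`, the (27)-type chain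
`|e^Z − 1| ≤ e^{|Z|} − 1 ≤ e^{|Z|}|Z|` at `Z = i·Σ…`, no domain condition; tree `AreaLaw.exp_sub_one_le_mul_exp`),
`c163` (the `O(1)` of (162)/(163) made explicit: `c = 8d e^{2α₁d} e^{8dα₁e^{2α₁d}}`), `bound162_mul_exp_le`,
`ineq163_barAvg_of_162` (the (162) middle-member bounds at `ℓ_j = L^jη`, `η = L^{-k}`, `j < k`, feed the
hypothesis `hstep` of `B7Prop6Bound.ineq163_explicit`, giving (163) for the product (160) of the `k` block averages
with `O(1)·α₁ = e^{2cα₁} − 1 ≤ 2cα₁e^{2cα₁}`), and `ineq163_barAvg_of_161` (end to end from per-path (161)-data for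
all `j < k`, under `2dα₁ ≤ 1/3`, `L ≥ 2`).
RESIDUAL (printed inputs, NOT certified, unchanged): (161) itself = Proposition 4 / (131) (`B7.Prop4to6` stays an
input of `B7.lean`), and the READING of the symbol `(R̄^j_{0,x}U̿′^j)(Γ_{x,x_j})` as a path product of `≤ d(L−1)`
factors `W_i e^{B_i} W′_i` (header of `B7Transfer` §2).  DIVERGENCE (cell row D-b07g3.1): print's "for `α₁`
sufficiently small" (p. 42) is typed as the explicit conditions `2dα₁(Lℓ) ≤ 1/8` (first equality of (162); cf. the
radius `1/8` of (28) p. 22) and `2dα₁ ≤ 1/3` (the bound (163)); print's strict `<` are typed `≤` under non-strict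
hypotheses (print ⇒ typed), as in `B7Transfer`/`B7TransferLog`; (163)'s `O(1)` is the explicit `c163`.
Unit `b2b-balaban-b07-g3` (paper sub-cell B07 gen 3; journal claim G-B7t-162EQ-KERNEL).  Value = kernel
certificate of printed internal implications, NOT summit progress.
-/

noncomputable section

open NormedSpace Set Filter Topology Metric

namespace Literature.MathematicalPhysics.QuantumFieldTheory.Balaban1983to89.B7BlockAvgLog

open B7Prop6Bound B7Transfer B7TransferLog MatrixLog Finset
open Literature.Analysis.Complex (logOnePlus logSeriesCoeff mem_eball_expSeries_radius)

variable {𝔸 : Type*} [NormedRing 𝔸] [NormedAlgebra ℂ 𝔸] [CompleteSpace 𝔸]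

/-! ## §1 `log ∘ exp = id` on small elements ("It is an inverse to the exponential function", p. 21) -/

omit [CompleteSpace 𝔸] in
/-- An element commuting with `y` commutes with the logarithmic series (21) at `y`, `logOnePlus y` (termwise
`Commute.pow_right`/`Commute.smul_right`, then `Commute.tsum_right`, which needs no summability). [folklore] -/
theorem commute_logOnePlus_right {x y : 𝔸} (h : Commute x y) : Commute x (logOnePlus y) := by
  show Commute x (∑' n : ℕ, logSeriesCoeff n • y ^ n)
  exact Commute.tsum_right x fun n => (h.pow_right n).smul_right (logSeriesCoeff n)

omit [CompleteSpace 𝔸] in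
/-- An element commuting with `X` commutes with `log X` (21). [folklore] -/
theorem commute_mlog_right {x X : 𝔸} (h : Commute x X) : Commute x (mlog X) := by
  rw [mlog_def]
  exact commute_logOnePlus_right (h.sub_right (Commute.one_right x))

/-- Injectivity of `exp` at `1` on the open unit ball: `‖D‖ < 1` and `e^D = 1` force `D = 0` — from
`‖D‖ = ‖e^D − 1 − D‖ ≤ e^{‖D‖} − 1 − ‖D‖ ≤ ‖D‖²` (tree `OneLinkLaplace.norm_exp_sub_one_sub_le_sq`, module
`TiltedExponentMorseBounds`). [folklore] -/
theorem eq_zero_of_exp_eq_one {D : 𝔸} (hD : ‖D‖ < 1) (h : exp D = 1) : D = 0 := by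
  have h1 := OneLinkLaplace.norm_exp_sub_one_sub_le_sq hD.le
  rw [h, sub_self, zero_sub, norm_neg] at h1
  have h4 : ‖D‖ ≤ 0 := by nlinarith [norm_nonneg D]
  exact norm_eq_zero.mp (le_antisymm h4 (norm_nonneg D))

/-- Radius bookkeeping: for `‖C‖ < ln 2` and `s ∈ [0,1]`, `‖e^{sC} − 1‖ ≤ e^{‖C‖} − 1 < 1`, so `e^{sC}` lies in the
domain `|X − 1| < 1` of the series (21). [folklore] -/
theorem norm_exp_smul_sub_one_lt_one {C : 𝔸} (hC : ‖C‖ < Real.log 2) {s : ℝ} (hs : s ∈ Icc (0 : ℝ) 1) :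
    ‖exp ((s : ℂ) • C) - 1‖ < 1 := by
  have h1 : ‖(s : ℂ) • C‖ ≤ ‖C‖ := by
    rw [norm_smul, Complex.norm_of_nonneg hs.1]
    exact mul_le_of_le_one_left (norm_nonneg _) hs.2
  have h2 := Literature.Analysis.Calculus.norm_exp_sub_one_le ((s : ℂ) • C)
  have h3 : Real.exp ‖(s : ℂ) • C‖ ≤ Real.exp ‖C‖ := Real.exp_le_exp.mpr h1
  have h4 : Real.exp ‖C‖ < 2 := by
    calc Real.exp ‖C‖ < Real.exp (Real.log 2) := Real.exp_lt_exp.mpr hC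
      _ = 2 := Real.exp_log two_pos
  linarith

/-- **`log ∘ exp = id` on small elements** — the direction of "It is an inverse to the exponential function"
(p. 21) that `MatrixLog.exp_mlog` does not give: for `‖C‖ < ln 2`, `log e^C = C` with `log` the series (21).
Proof by continuity induction on `[0,1]` (Mathlib `IsClosed.Icc_subset_of_forall_mem_nhdsWithin`): the map
`s ↦ D(s) = log e^{sC} − sC` is continuous on `[0,1]` (`analyticAt_mlog`), satisfies `e^{D(s)} = 1` (every term
commutes with `C`: `commute_mlog_right`, `Commute.exp_right`, `exp_add_of_commute_of_mem_ball`, `exp_mlog`) and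
`D(0) = 0`; where `D(s) = 0` it stays `0` on a neighbourhood, by `eq_zero_of_exp_eq_one`.  The radius `ln 2` is
sharp for the series (`𝔸 = ℂ`, `C = ln 2`). [folklore] -/
theorem mlog_exp {C : 𝔸} (hC : ‖C‖ < Real.log 2) : mlog (exp C) = C := by
  let f : ℝ → 𝔸 := fun r => mlog (exp ((r : ℂ) • C)) - (r : ℂ) • C
  have hf : ∀ r, f r = mlog (exp ((r : ℂ) • C)) - (r : ℂ) • C := fun r => rfl
  -- (i) every value of `f` on `[0,1]` is a logarithm of `1`
  have hexp : ∀ s ∈ Icc (0 : ℝ) 1, exp (f s) = 1 := by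
    intro s hs
    have hc : Commute ((s : ℂ) • C) (mlog (exp ((s : ℂ) • C))) :=
      commute_mlog_right ((Commute.refl ((s : ℂ) • C)).exp_right)
    rw [hf, sub_eq_add_neg, exp_add_of_commute_of_mem_ball hc.symm.neg_right
        (mem_eball_expSeries_radius _) (mem_eball_expSeries_radius _),
      exp_mlog (norm_exp_smul_sub_one_lt_one hC hs),
      ← exp_add_of_commute_of_mem_ball ((Commute.refl ((s : ℂ) • C)).neg_right)
        (mem_eball_expSeries_radius _) (mem_eball_expSeries_radius _), add_neg_cancel, exp_zero]
  -- (ii) `f` is continuous at every point of `[0,1]`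
  have hlin : Continuous fun r : ℝ => (r : ℂ) • C := Complex.continuous_ofReal.smul continuous_const
  have hexpc : Continuous (exp : 𝔸 → 𝔸) :=
    continuous_iff_continuousAt.2 fun x => (exp_analytic (𝕂 := ℂ) x).continuousAt
  have hE : Continuous fun r : ℝ => exp ((r : ℂ) • C) := hexpc.comp hlin
  have hcont : ∀ s ∈ Icc (0 : ℝ) 1, ContinuousAt f s := by
    intro s hs
    have hg : ContinuousAt (fun r : ℝ => mlog (exp ((r : ℂ) • C))) s :=
      (analyticAt_mlog (norm_exp_smul_sub_one_lt_one hC hs)).continuousAt.comp'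
        (f := fun r : ℝ => exp ((r : ℂ) • C)) hE.continuousAt
    exact hg.sub hlin.continuousAt
  -- (iii) continuity induction: the zero set of `f` contains `[0,1]`
  have hsub : Icc (0 : ℝ) 1 ⊆ f ⁻¹' {0} := by
    refine IsClosed.Icc_subset_of_forall_mem_nhdsWithin ?_ ?_ ?_
    · rw [Set.inter_comm]
      exact ContinuousOn.preimage_isClosed_of_isClosed (fun s hs => (hcont s hs).continuousWithinAt)
        isClosed_Icc isClosed_singleton
    · show f 0 = 0
      rw [hf]
      simp [exp_zero]
    · rintro s ⟨hs', hs0, hs1⟩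
      have hs : s ∈ Icc (0 : ℝ) 1 := ⟨hs0, hs1.le⟩
      have hzero : f s = 0 := hs'
      have hball : ball (0 : 𝔸) 1 ∈ 𝓝 (f s) := by
        rw [hzero]
        exact ball_mem_nhds _ one_pos
      have hev1 : ∀ᶠ r in 𝓝 s, ‖f r‖ < 1 := by
        filter_upwards [(hcont s hs).eventually_mem hball] with r hr
        rwa [mem_ball_zero_iff] at hr
      have hev2 : ∀ᶠ r in 𝓝[>] s, r ∈ Ioo s 1 := Ioo_mem_nhdsGT hs1
      filter_upwards [hev1.filter_mono nhdsWithin_le_nhds, hev2] with r hr1 hr2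
      exact eq_zero_of_exp_eq_one hr1 (hexp r ⟨hs0.trans hr2.1.le, hr2.2.le⟩)
  have h1 : f 1 = 0 := hsub ⟨zero_le_one, le_rfl⟩
  rw [hf] at h1
  simpa [sub_eq_zero] using h1

/-! ## §2 The carrier: the average `\overline{W}` of group-valued site variables -/

/-- **The block average of group-valued site variables** — the printed shape
`exp[i Σ_{x∈B(y)} L^{-d} (1/i) log W(Γ_{y,x})]` of (42) p. 23 / (43) p. 24 (there followed by the base-point factor
`U(c)`), of (78) p. 30 (preceded by `v(y)`), and of the symbol `\overline{R_{0,x₁}U₁}` "defined by the last equation"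
(82) p. 30, which is the object under the bar in (160)–(162) p. 42: index set `t` (the sites `x ∈ B(y)`), real
weights `wt` (in print `L^{-d}`), site variables `W x` (in print `W(Γ_{y,x})`), `log` = the series (21)
`MatrixLog.mlog`.  The same NORMALISED shape is printed once more in Sect. D, p. 34 [PDF 18] (110):
"`\overline{R_{0,y}V₁} = exp[i Σ_{x∈B(y)} L^{-d} (1/i) log(R_{0,y}V₁)(Γ_{y,x})]`" (the object expanded in
(111)–(112) and entering (89)/(120)).
WHICH BAR (cell census G-adv4-8 (i), a convention the print leaves implicit): the BOND average (42) is
`exp[i Σ_{x∈B(c₋)} L^{-d}(1/i) log W_xW_c^{-1}]·W_c` — base point W_c = U(c) on the RIGHT — whereas the BLOCK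
average of G-valued site variables (78) line 1, and every unnamed `{…}‾_{x∈B(y)}` of (83), (85), (100), is
`W_y·exp[i Σ_{x∈B(y)} L^{-d}(1/i) log W_y^{-1}W_x]` — base point W_y on the LEFT (left-covariant: `{gW}‾ = g{W}‾`
for constant g, which (83)/(100) use); the two agree only for commuting variables.  `barAvg` is the normalised
carrier common to both AFTER the base-point factor has been divided out (for (42): the variables `W_xW_c^{-1}`;
for (78)/(85): `W_y^{-1}W_x` — in (85) the base value v_j(x_{j+1}) ≠ 1 must be stripped first; for (82)/(110)/(162)
the base value is 1 and `barAvg` is the printed object itself). [cite: Balaban1985Averaging, (42) p.23, (78)/(82) p.30, (110) p.34] -/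
def barAvg {ι : Type*} (t : Finset ι) (wt : ι → ℝ) (W : ι → 𝔸) : 𝔸 :=
  exp (Complex.I • ∑ x ∈ t, wt x • ((Complex.I⁻¹ : ℂ) • mlog (W x)))

omit [CompleteSpace 𝔸] in
/-- The factors `i`, `1/i` of the printed formula cancel: `i·Σ_x wt_x (1/i) m_x = Σ_x wt_x m_x`. [folklore] -/
theorem I_smul_sum_Iinv_smul {ι : Type*} (t : Finset ι) (wt : ι → ℝ) (m : ι → 𝔸) :
    Complex.I • ∑ x ∈ t, wt x • ((Complex.I⁻¹ : ℂ) • m x) = ∑ x ∈ t, wt x • m x := by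
  rw [Finset.smul_sum]
  refine Finset.sum_congr rfl fun x _ => ?_
  rw [← smul_comm (wt x) Complex.I ((Complex.I⁻¹ : ℂ) • m x), smul_smul,
    mul_inv_cancel₀ Complex.I_ne_zero, one_smul]

omit [CompleteSpace 𝔸] in
/-- The carrier unfolded: `\overline{W} = exp(Σ_x wt_x log W_x)`. [cite: Balaban1985Averaging, (78)/(82) p.30] -/
theorem barAvg_eq_exp_sum {ι : Type*} (t : Finset ι) (wt : ι → ℝ) (W : ι → 𝔸) :
    barAvg t wt W = exp (∑ x ∈ t, wt x • mlog (W x)) := by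
  rw [barAvg, I_smul_sum_Iinv_smul]

omit [CompleteSpace 𝔸] in
/-- `‖(1/i)·a‖ = ‖a‖`. [folklore] -/
theorem norm_Iinv_smul (a : 𝔸) : ‖(Complex.I⁻¹ : ℂ) • a‖ = ‖a‖ := by
  rw [norm_smul, norm_inv, Complex.norm_I, inv_one, one_mul]

/-! ## §3 The first equality of (162), and the whole chain (162) for B7's block average -/

/-- **First equality of (162)** (p. 42): `(1/i) log \overline{W} = Σ_x wt_x (1/i) log W_x` whenever the right-hand
side has norm `< ln 2`, so that `i×` it lies in the `log ∘ exp` domain of `mlog_exp` — definition (78)/(82) of the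
bar followed by `log ∘ exp = id`. [cite: Balaban1985Averaging, (162) p.42] -/
theorem ineq162_firstEq {ι : Type*} (t : Finset ι) (wt : ι → ℝ) (W : ι → 𝔸)
    (hZ : ‖∑ x ∈ t, wt x • ((Complex.I⁻¹ : ℂ) • mlog (W x))‖ < Real.log 2) :
    (Complex.I⁻¹ : ℂ) • mlog (barAvg t wt W) = ∑ x ∈ t, wt x • ((Complex.I⁻¹ : ℂ) • mlog (W x)) := by
  have hIZ : ‖Complex.I • ∑ x ∈ t, wt x • ((Complex.I⁻¹ : ℂ) • mlog (W x))‖ < Real.log 2 := by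
    rwa [norm_smul, Complex.norm_I, one_mul]
  rw [barAvg, mlog_exp hIZ, smul_smul, inv_mul_cancel₀ Complex.I_ne_zero, one_smul]

/-- First equality of (162) together with its LEFT member bound, from a uniform per-site bound: for convex weights
(`wt ≥ 0`, `Σ wt = 1`; in print `L^{-d}` over the `L^d` sites of `B(x)`) and `‖log W_x‖ ≤ K` for all sites with
`K < ln 2`, `(1/i) log \overline{W} = Σ_x wt_x (1/i) log W_x` and `‖(1/i) log \overline{W}‖ ≤ K`
(`B7Transfer.convex_comb_norm_le`, `ineq162_firstEq`). [cite: Balaban1985Averaging, (162) p.42] -/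
theorem ineq162_first_of_bound {ι : Type*} (t : Finset ι) (wt : ι → ℝ) (W : ι → 𝔸) {K : ℝ}
    (hw : ∀ x ∈ t, 0 ≤ wt x) (hsum : ∑ x ∈ t, wt x = 1)
    (hK : ∀ x ∈ t, ‖mlog (W x)‖ ≤ K) (hKlt : K < Real.log 2) :
    (Complex.I⁻¹ : ℂ) • mlog (barAvg t wt W) = ∑ x ∈ t, wt x • ((Complex.I⁻¹ : ℂ) • mlog (W x)) ∧
      ‖(Complex.I⁻¹ : ℂ) • mlog (barAvg t wt W)‖ ≤ K := by
  have hZ : ‖∑ x ∈ t, wt x • ((Complex.I⁻¹ : ℂ) • mlog (W x))‖ ≤ K :=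
    convex_comb_norm_le t wt _ hw hsum fun x hx => by rw [norm_Iinv_smul]; exact hK x hx
  have heq := ineq162_firstEq t wt W (hZ.trans_lt hKlt)
  refine ⟨heq, ?_⟩
  rw [heq]
  exact hZ

/-- The smallness that puts the (162) bound inside the `log ∘ exp` radius: if `2dα₁(Lℓ) ≤ 1/8` then
`8α₁d(Lℓ)e^{2α₁d(Lℓ)} ≤ (1/2)e^{1/8} < 4/7 < ln 2` (`Real.exp_bound_div_one_sub_of_interval'`,
`Real.log_two_gt_d9`).  Print: "for `α₁` sufficiently small" (p. 42); cf. the radius `1/8` of (28) p. 22.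
[folklore] -/
theorem rad162_of_small {d L α₁ ℓ : ℝ} (h : 2 * d * α₁ * (L * ℓ) ≤ 1 / 8) :
    8 * α₁ * d * (L * ℓ) * Real.exp (2 * α₁ * d * (L * ℓ)) < Real.log 2 := by
  have h8 : 8 * α₁ * d * (L * ℓ) = 4 * (2 * α₁ * d * (L * ℓ)) := by ring
  rw [h8]
  generalize hu : 2 * α₁ * d * (L * ℓ) = u
  have hu' : u ≤ 1 / 8 := by rw [← hu]; linarith
  have hlog := Real.log_two_gt_d9
  rcases lt_or_ge u 0 with hneg | hnonneg
  · have : 4 * u * Real.exp u < 0 := mul_neg_of_neg_of_pos (by linarith) (Real.exp_pos u)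
    linarith
  · have he : Real.exp u < 8 / 7 := by
      have h1 := Real.exp_bound_div_one_sub_of_interval' (show (0 : ℝ) < 1 / 8 by norm_num) (by norm_num)
      have h2 : Real.exp u ≤ Real.exp (1 / 8) := Real.exp_le_exp.mpr hu'
      have h3 : (1 : ℝ) / (1 - 1 / 8) = 8 / 7 := by norm_num
      linarith
    have h4 : 4 * u * Real.exp u ≤ 4 * (1 / 8) * Real.exp u :=
      mul_le_mul_of_nonneg_right (by linarith) (Real.exp_pos u).le
    linarith

/-- **(162), the whole printed chain, for B7's own block average** (p. 42): with `W_x` the path products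
`∏_{i<s(x)} W_{x,i} e^{B_{x,i}} W′_{x,i}` of `B7TransferLog.ineq162_blockAvg_of_161` (the READING of
`(R̄^j_{0,x}U̿′^j)(Γ_{x,x_j})`, header of `B7Transfer` §2: `s(x) ≤ d(L−1)` factors, `W_{x,i}W′_{x,i} = 1`, norms `≤ 1`,
`‖B_{x,i}‖ ≤ 2α₁ℓ`, `ℓ = L^jη`), convex weights, and the smallness `2dα₁(Lℓ) ≤ 1/8` (print: "for `α₁` sufficiently
small"; it implies the `≤ 1/3` of `B7TransferLog`), the LEFT member of (162) equals the MIDDLE member and is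
`≤ 8α₁d(Lℓ)e^{2α₁d(Lℓ)}`.  Print has strict `<`; typed `≤` under non-strict hypotheses (print ⇒ typed).
[cite: Balaban1985Averaging, (161)–(162) p.42] -/
theorem ineq162_barAvg_of_161 {ι : Type*} (t : Finset ι) (wt : ι → ℝ)
    (hw : ∀ x ∈ t, 0 ≤ wt x) (hsum : ∑ x ∈ t, wt x = 1)
    (W B W' : ι → ℕ → 𝔸) (s : ι → ℕ) {d L α₁ ℓ : ℝ}
    (hs : ∀ x ∈ t, (s x : ℝ) ≤ d * (L - 1)) (hd : 0 ≤ d) (hα : 0 ≤ α₁) (hℓ : 0 ≤ ℓ)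
    (hWW' : ∀ x ∈ t, ∀ i < s x, W x i * W' x i = 1) (hW : ∀ x ∈ t, ∀ i < s x, ‖W x i‖ ≤ 1)
    (hW' : ∀ x ∈ t, ∀ i < s x, ‖W' x i‖ ≤ 1) (hB : ∀ x ∈ t, ∀ i < s x, ‖B x i‖ ≤ 2 * α₁ * ℓ)
    (hsmall : 2 * d * α₁ * (L * ℓ) ≤ 1 / 8) :
    (Complex.I⁻¹ : ℂ) • mlog (barAvg t wt fun x => oprod (fun i => W x i * exp (B x i) * W' x i) (s x))
        = ∑ x ∈ t, wt x • ((Complex.I⁻¹ : ℂ) • mlog (oprod (fun i => W x i * exp (B x i) * W' x i) (s x))) ∧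
      ‖(Complex.I⁻¹ : ℂ) • mlog (barAvg t wt fun x => oprod (fun i => W x i * exp (B x i) * W' x i) (s x))‖
        ≤ 8 * α₁ * d * (L * ℓ) * Real.exp (2 * α₁ * d * (L * ℓ)) := by
  have hsmall' : 2 * d * α₁ * (L * ℓ) ≤ 1 / 3 := hsmall.trans (by norm_num)
  refine ineq162_first_of_bound t wt _ hw hsum (fun x hx => ?_) (rad162_of_small hsmall)
  have h := (ineq162_log_of_161 (W x) (B x) (W' x) (s x) (hs x hx) hd hα hℓ (hWW' x hx) (hW x hx)
    (hW' x hx) (hB x hx) hsmall').1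
  rwa [norm_Iinv_smul] at h

/-! ## §4 The seam (162) ⇒ (163) -/

/-- (162) ⇒ (163), one factor: `‖\overline{W} − 1‖ ≤ Ke^K` whenever `‖Σ_x wt_x (1/i) log W_x‖ ≤ K` — the
(27)-type chain `|e^Z − 1| ≤ e^{|Z|} − 1 ≤ e^{|Z|}|Z|` (p. 22) at `Z = i·Σ…` (`B7Transfer.norm_exp_sub_one_le_of_le`,
`AreaLaw.exp_sub_one_le_mul_exp`); no domain condition. [cite: Balaban1985Averaging, (27) p.22, (162)–(163) p.42] -/
theorem norm_barAvg_sub_one_le {ι : Type*} (t : Finset ι) (wt : ι → ℝ) (W : ι → 𝔸) {K : ℝ}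
    (hZ : ‖∑ x ∈ t, wt x • ((Complex.I⁻¹ : ℂ) • mlog (W x))‖ ≤ K) :
    ‖barAvg t wt W - 1‖ ≤ K * Real.exp K := by
  have hIZ : ‖Complex.I • ∑ x ∈ t, wt x • ((Complex.I⁻¹ : ℂ) • mlog (W x))‖ ≤ K := by
    rwa [norm_smul, Complex.norm_I, one_mul]
  calc ‖barAvg t wt W - 1‖ ≤ Real.exp K - 1 := norm_exp_sub_one_le_of_le _ hIZ
    _ ≤ K * Real.exp K := AreaLaw.exp_sub_one_le_mul_exp K

/-- The `O(1)` of (162)/(163) made explicit: with `c₁ = 8d e^{2α₁d}` (the (162) constant once `L^{j+1}η ≤ 1`, as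
in the header of `B7Prop6Bound`), each factor of (160) obeys `‖a_j − 1‖ ≤ K_je^{K_j} ≤ c₁e^{c₁α₁}·α₁L^{j+1}η`
(`bound162_mul_exp_le`), so the constant `c` of `B7Prop6Bound.ineq163_explicit` is `c163 d α₁ = c₁ e^{c₁α₁}`,
bounded for `α₁` in any bounded range. [cite: Balaban1985Averaging, (162)–(163) p.42] -/
def c163 (d α₁ : ℝ) : ℝ :=
  8 * d * Real.exp (2 * α₁ * d) * Real.exp (8 * d * Real.exp (2 * α₁ * d) * α₁)

/-- `c163 d α₁ ≥ 0` for `d ≥ 0`. [folklore] -/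
theorem c163_nonneg {d α₁ : ℝ} (hd : 0 ≤ d) : 0 ≤ c163 d α₁ := by
  unfold c163
  positivity

/-- Real arithmetic of the seam: for `0 ≤ x ≤ 1` (`x = L^{j+1}η`), `α₁, d ≥ 0`, the factor bound `K e^K` with
`K = 8α₁d·x·e^{2α₁dx}` is `≤ c163 d α₁ · α₁ · x`. [folklore] -/
theorem bound162_mul_exp_le {d α₁ x : ℝ} (hd : 0 ≤ d) (hα : 0 ≤ α₁) (hx0 : 0 ≤ x) (hx1 : x ≤ 1) :
    8 * α₁ * d * x * Real.exp (2 * α₁ * d * x) * Real.exp (8 * α₁ * d * x * Real.exp (2 * α₁ * d * x))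
      ≤ c163 d α₁ * α₁ * x := by
  unfold c163
  have hαd : 0 ≤ α₁ * d := mul_nonneg hα hd
  have h1 : Real.exp (2 * α₁ * d * x) ≤ Real.exp (2 * α₁ * d) := by
    apply Real.exp_le_exp.mpr
    nlinarith
  have hK : 8 * α₁ * d * x * Real.exp (2 * α₁ * d * x) ≤ 8 * d * Real.exp (2 * α₁ * d) * α₁ * x := by
    have h0 : 0 ≤ 8 * α₁ * d * x := by positivity
    calc 8 * α₁ * d * x * Real.exp (2 * α₁ * d * x) ≤ 8 * α₁ * d * x * Real.exp (2 * α₁ * d) :=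
          mul_le_mul_of_nonneg_left h1 h0
      _ = 8 * d * Real.exp (2 * α₁ * d) * α₁ * x := by ring
  have hK' : 8 * α₁ * d * x * Real.exp (2 * α₁ * d * x) ≤ 8 * d * Real.exp (2 * α₁ * d) * α₁ := by
    refine hK.trans ?_
    have h0 : 0 ≤ 8 * d * Real.exp (2 * α₁ * d) * α₁ := by positivity
    calc 8 * d * Real.exp (2 * α₁ * d) * α₁ * x ≤ 8 * d * Real.exp (2 * α₁ * d) * α₁ * 1 :=
          mul_le_mul_of_nonneg_left hx1 h0
      _ = 8 * d * Real.exp (2 * α₁ * d) * α₁ := mul_one _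
  have h2 : Real.exp (8 * α₁ * d * x * Real.exp (2 * α₁ * d * x))
      ≤ Real.exp (8 * d * Real.exp (2 * α₁ * d) * α₁) := Real.exp_le_exp.mpr hK'
  calc 8 * α₁ * d * x * Real.exp (2 * α₁ * d * x) * Real.exp (8 * α₁ * d * x * Real.exp (2 * α₁ * d * x))
      ≤ (8 * d * Real.exp (2 * α₁ * d) * α₁ * x) * Real.exp (8 * d * Real.exp (2 * α₁ * d) * α₁) :=
        mul_le_mul hK h2 (Real.exp_pos _).le (by positivity)
    _ = 8 * d * Real.exp (2 * α₁ * d) * Real.exp (8 * d * Real.exp (2 * α₁ * d) * α₁) * α₁ * x := by ring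

/-- **(162) ⇒ (163)** (p. 42).  If for each `j < k` the `j`-th block average `a_j = \overline{W_j}` (its own index
set `t j` and weights `wt j`) satisfies the middle/right members of (162) at `ℓ_j = L^jη`, `η = L^{-k}`:
`‖Σ_x wt (1/i) log W_{j,x}‖ ≤ 8α₁d·x_j·e^{2α₁d x_j}`, `x_j = L^{j+1}η = L^{j+1}/L^k`, then the product (160)
`v_k = a_0a_1⋯a_{k−1}` (`B7Prop6Bound.oprod`) obeys (163) in the explicit form of `B7Prop6Bound.ineq163_explicit`:
`‖v_k − 1‖ ≤ e^{2cα₁} − 1 ≤ 2cα₁e^{2cα₁}`, `c = c163 d α₁` (`L ≥ 2` gives `Σ_{j<k} L^{j+1}η ≤ 2`).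
[cite: Balaban1985Averaging, (160)–(163) p.42] -/
theorem ineq163_barAvg_of_162 {ι : Type*} (k : ℕ) (t : ℕ → Finset ι) (wt : ℕ → ι → ℝ) (W : ℕ → ι → 𝔸)
    {d L α₁ : ℝ} (hL : 2 ≤ L) (hd : 0 ≤ d) (hα : 0 ≤ α₁)
    (h162 : ∀ j < k, ‖∑ x ∈ t j, wt j x • ((Complex.I⁻¹ : ℂ) • mlog (W j x))‖
      ≤ 8 * α₁ * d * (L ^ (j + 1) / L ^ k) * Real.exp (2 * α₁ * d * (L ^ (j + 1) / L ^ k))) :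
    ‖oprod (fun j => barAvg (t j) (wt j) (W j)) k - 1‖ ≤ Real.exp (2 * c163 d α₁ * α₁) - 1 ∧
      Real.exp (2 * c163 d α₁ * α₁) - 1 ≤ 2 * c163 d α₁ * α₁ * Real.exp (2 * c163 d α₁ * α₁) := by
  have hL0 : 0 < L := by linarith
  refine ineq163_explicit (fun j => barAvg (t j) (wt j) (W j)) k L (c163 d α₁) α₁ hL (c163_nonneg hd) hα
    fun j hj => ?_
  have hx0 : 0 ≤ L ^ (j + 1) / L ^ k := by positivity
  have hx1 : L ^ (j + 1) / L ^ k ≤ 1 := by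
    rw [div_le_one (pow_pos hL0 k)]
    exact pow_le_pow_right₀ (by linarith) (by omega)
  exact (norm_barAvg_sub_one_le (t j) (wt j) (W j) (h162 j hj)).trans (bound162_mul_exp_le hd hα hx0 hx1)

/-- **(161) ⇒ (162) ⇒ (163), end to end, for the product (160) of B7's block averages** (p. 42): per averaging
step `j < k` and site `x ∈ t j` a path product of `s j x ≤ d(L−1)` factors `W e^{B} W′` with `WW′ = 1`, norms
`≤ 1` and the (161)-bound `‖B‖ ≤ 2α₁L^jη` (`η = L^{-k}`), convex weights, `L ≥ 2`, and the smallness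
`2dα₁ ≤ 1/3` (print: "for `α₁` sufficiently small"; it gives `B7TransferLog`'s `2dα₁(Lℓ_j) ≤ 1/3` since
`Lℓ_j = L^{j+1}η ≤ 1`) yield (163) with the explicit constant `c163`.  The first equality of (162) is not needed
for (163) (only the norm of the exponent enters).  Printed inputs NOT certified: (161) (Prop. 4/(131)) and the
reading of the path symbols. [cite: Balaban1985Averaging, (160)–(163) p.42] -/
theorem ineq163_barAvg_of_161 {ι : Type*} (k : ℕ) (t : ℕ → Finset ι) (wt : ℕ → ι → ℝ)
    (hw : ∀ j < k, ∀ x ∈ t j, 0 ≤ wt j x) (hsum : ∀ j < k, ∑ x ∈ t j, wt j x = 1)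
    (W B W' : ℕ → ι → ℕ → 𝔸) (s : ℕ → ι → ℕ) {d L α₁ : ℝ} (hL : 2 ≤ L) (hd : 0 ≤ d) (hα : 0 ≤ α₁)
    (hs : ∀ j < k, ∀ x ∈ t j, (s j x : ℝ) ≤ d * (L - 1))
    (hWW' : ∀ j < k, ∀ x ∈ t j, ∀ i < s j x, W j x i * W' j x i = 1)
    (hW : ∀ j < k, ∀ x ∈ t j, ∀ i < s j x, ‖W j x i‖ ≤ 1)
    (hW' : ∀ j < k, ∀ x ∈ t j, ∀ i < s j x, ‖W' j x i‖ ≤ 1)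
    (hB : ∀ j < k, ∀ x ∈ t j, ∀ i < s j x, ‖B j x i‖ ≤ 2 * α₁ * (L ^ j / L ^ k))
    (hsmall : 2 * d * α₁ ≤ 1 / 3) :
    ‖oprod (fun j => barAvg (t j) (wt j) fun x =>
          oprod (fun i => W j x i * exp (B j x i) * W' j x i) (s j x)) k - 1‖
        ≤ Real.exp (2 * c163 d α₁ * α₁) - 1 ∧
      Real.exp (2 * c163 d α₁ * α₁) - 1 ≤ 2 * c163 d α₁ * α₁ * Real.exp (2 * c163 d α₁ * α₁) := by
  refine ineq163_barAvg_of_162 k t wt _ hL hd hα fun j hj => ?_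
  have hL0 : 0 < L := by linarith
  have hℓ : 0 ≤ L ^ j / L ^ k := by positivity
  have hx : L * (L ^ j / L ^ k) = L ^ (j + 1) / L ^ k := by
    rw [pow_succ]
    ring
  have hx1 : L ^ (j + 1) / L ^ k ≤ 1 := by
    rw [div_le_one (pow_pos hL0 k)]
    exact pow_le_pow_right₀ (by linarith) (by omega)
  have hsmallj : 2 * d * α₁ * (L * (L ^ j / L ^ k)) ≤ 1 / 3 := by
    rw [hx]
    have h0 : 0 ≤ 2 * d * α₁ := by positivity
    calc 2 * d * α₁ * (L ^ (j + 1) / L ^ k) ≤ 2 * d * α₁ * 1 := mul_le_mul_of_nonneg_left hx1 h0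
      _ ≤ 1 / 3 := by linarith
  have h := ineq162_blockAvg_of_161 (t j) (wt j) (hw j hj) (hsum j hj) (W j) (B j) (W' j) (s j)
    (hs j hj) hd hα hℓ (hWW' j hj) (hW j hj) (hW' j hj) (hB j hj) hsmallj
  rwa [hx] at h

end Literature.MathematicalPhysics.QuantumFieldTheory.Balaban1983to89.B7BlockAvgLog
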